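import Literature.MathematicalPhysics.QuantumFieldTheory.Balaban1983to89.T3MinimiserStabilityReduction
import Literature.MathematicalPhysics.QuantumFieldTheory.Balaban1983to89.T3PrintedRegularMinimiser
import Literature.MathematicalPhysics.QuantumFieldTheory.Balaban1983to89.T3OrbitAverage
import Literature.MathematicalPhysics.QuantumFieldTheory.Balaban1983to89.B12ContinuousTransportInvariance
import Literature.MathematicalPhysics.QuantumFieldTheory.Balaban1983to89.Node00.CanonicalTransportOfRecord
import HarnessLib

/-!
# LINE g24-4 «BACKGROUND FORM» — S2β and GRAD∘ from ONE print-shaped row whose terms are local in the BACKGROUND FIELD, by the PROVED sensitivity algebra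
(ideator `ym-r3-idea-1` g24, lens «control»; crux `stmt-QuantumFields-20520` = `UnitScaleTilt.FluctuationComparisonRegPrIntL`, rung R3 = continuum SU(2) YM₃ on T³)

TARGETS (concluded BY NAME, texts byte-identical, §0): the PATH-B organ **S2β** `FluctuationPartSmall` (registry `Lines/semiclassical_s2beta.lean` v11.4 §2 =
`Lines/runpair_organ.lean`) and the first-order row **GRAD∘** `OneBondOscillationCan` of LINE g24-1 (`Lines/gradient_split.lean` §0).

THE OBSERVATION (control lens, fourth pass = ERRATUM E1 of LINE g24-3 made into a line).  LINE g24-3 docks S2β on POLY∘: `log ρ + β_K𝔄^reg = c₀ + Σ_X T_X(U)` with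
`T_X` EXACTLY local in the WINDOW field `U`.  Print's localized terms are NOT that: the small-field terms `E^{(j)}(X, U_k(V))` of [Balaban1987RG1] (0.22)–(0.24)
pp.256–257 and the `R`-terms of [Balaban1989LargeFieldII] (1.98)–(1.100) p.390 are local in the BACKGROUND (minimal) configuration `U_k(V)` restricted to `X̃`
([Balaban1985UV3] p.263 «depends on U₁ restricted to X̃»; typed shape `T3AlphaInputsAC.AlphaDataT3.IsLocal`), and the background map `V ↦ U_k(V)` is NOT local —
it is ANALYTIC with an exponentially decaying one-bond response ([Balaban1985Variational] Sect. G p.305, Prop. 9 p.309, (182)–(190) pp.307–308: «this derivative has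
regularity and decay properties identical to the propagator H»; print's own caveat at (189): «We do not perform these calculations here … let us formulate a final
result only»).  The NEW ROW **BGFORM∘** `FluctuationBackgroundFormCan` says exactly this and nothing more (v2 typing, P1 of critic #496 repaired — see «v2» below): on the window,
`log ρ U + β_K𝔄^reg U = c₀ + Σ_X T_X(M U)` where `M U` = (η-scaled coordinates of) the background configuration on the FINE bonds of the run's top level `K`, the
terms `T_X` are indexed by finite sets `X` of COARSE (level-`J`) bonds and depend on the background variables in the blocks of `X` only (cell map `blk`), with
cell-sum LIPSCHITZ moduli `ℓ_X` (implied by sup-norm Lipschitz) and discrete-C^{1,1} moduli `h_X`, bounded ONE-pin sums (`Σ_{X∋c} ℓ_X ≤ A`) and exponentially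
decaying TWO-pin sums (`Σ_{X∋c,c′} h_X ≤ H·e^{−2μd(c,c′)}`) over COARSE cells, and the background map has per-fine-bond one-bond sensitivities `≤ σ_J e^{−2μ d(b, blk e)}`
and mixed two-bond sensitivities `≤ σ₂,J e^{−2μ d(b,blk e)} e^{−2μ d(blk e,b′)}` with `σ, σ₂` super-polynomially small in `J` (window diameter at one bond ≍ θ_J; two
bonds ≍ θ_J²), on a pseudo-metric `d` of the COARSE bonds with a volume-uniform summability constant `C` (a level-`J` count — `K` enters nowhere) and
`κ·tdist_J(b,b′) ≤ μ·d(b,b′)`.  From BGFORM∘ BOTH targets follow by the algebra PROVED in §2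
(= the toolkit `Lines/background_form_algebra.lean` 16a43cd95c52e6a8, inlined because crux workfiles are not importable, plus two exponential convolutions and the
super-polynomial bookkeeping): ✓`oneBondOscillation_of_backgroundForm : BGFORM∘ → GRAD∘` with `σ^{GRAD}_J = A·C·σ_J`, ✓`fluctuationPartSmall_of_backgroundForm :
BGFORM∘ → S2β` with `κ_{S2β} = κ`, `φ_J = H·C²·σ_J² + A·C·σ₂,J` — the `e^{−κ·tdist}` of S2β is MANUFACTURED from the decay of the background map's response through
the triangle inequality (`exp_convolution_le`), not assumed as a two-pin oscillation bound (contrast POLY∘ clause (iv)).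

WHAT THIS LINE SAYS ABOUT THE CONE (honest, problem-relative).  Cones for S2β on file: registry {EXW, GAP♯, DET-REP-B‴, H4ᶜ∘, LFR♯ᶜ∘}; g24-1 {GRAD∘, CRUDELOC}; g24-2
{OSC¹∘, TAILSUP∘, CRUDELOC}; g24-3 {POLY∘}; g24-4 {BGFORM∘}.  BGFORM∘ is WEAKER than POLY∘ (an exactly window-local representation is a background-form representation
with `K`-registers := a copy of the `U`-coordinates per block, `d` := a large multiple of the discrete metric — §1 remark) and CLOSER TO PRINT (v2: now carried
by the type, see «v2»): of the two standard-but-unprinted steps that LINE g24-3's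
card lists as load-bearing — (a) the cluster-expansion logarithm of the most recent large-field strata, (e) the minimiser re-localization — BGFORM∘ needs (a) only;
(e) is REPLACED by print's Prop. 9∕(190) (first order) and by analyticity in `B` + Cauchy on (190) (mixed second order; a corollary, not verbatim).  Size label:
«XL = transcription of RG1∕LF-II's output form for the T³ scheme + ONE cluster-expansion logarithm (a)».  Like POLY∘ it is a DOCKING ROW (it asserts structure S2β does
not; anti-reduction acknowledged); its use is that the junction algebra — the only problem-side mathematics between print's representation and the organ — is now
PROVED for the print-faithful form.
WHY IT MIGHT FAIL: (a) as in g24-3 (activities `e^{−p₀(g_k)}` vs stratum entropy in the last Mayer step — FIRST and load-bearing); (g) GAUGE ∕ CHART (promoted,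
critic #496 P3): the type lets `M` be ANY map into `Fin 8 → ℝ` per fine bond, `blk` ANY cell map and `d` ANY pseudo-metric — print-faithfulness («`M` = `U_k(V)` in
the Landau gauge, η-scaled») is a READING, not a constraint, and the register-chart witnesses (POLY∘-type) remain admissible; (b) dictionary (`descend`∕`ℰp` =
print's averaging and renormalisation); (c) the Lipschitz∕C^{1,1} moduli of the terms in the BACKGROUND variables with `e^{−κ·d(X)}`-small pinned sums are (0.25) +
analyticity (1.11)–(1.14) p.262 + Cauchy — a corollary; (d) torons∕wrapping domains `O(e^{−κN_J})` (φ after `F`); (f) NEW: the mixed second-order sensitivity clause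
with the PRODUCT kernel `e^{−2μd(b,blk e)}e^{−2μd(blk e,b′)}` is the natural Cauchy-estimate shape but is not printed.
v2 — P1 OF CRITIC #496 REPAIRED IN TYPES (scale clash of v1 5f0065306aa4d283: v1 summed `Σ_y e^{−μd(x,y)} ≤ C` over ALL FINE bonds with `C` fixed before `F`, which
forces every witness to have `J`-sparse response — a register chart, not `U_k(V)`).  v2: terms indexed by COARSE cells, registers on FINE bonds, cell map `blk`,
metric and every count on the COARSE lattice, per-fine-bond response bounds; the Lipschitz clause is the CELL-SUM form `|T_X(MU) − T_X(MV)| ≤ ℓ_X·Σ_{c∈X} S_c`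
whenever `‖MU e − MV e‖ ≤ S_{blk e}` on the blocks of `X` — implied by SUP-norm Lipschitz (`ℓ_X·max_c S_c`), which is the norm print's `E(X,·)` is Lipschitz in
(analytic and bounded on the sup-norm polydiscs (1.11)–(1.14), Cauchy).  ORDERS OF MAGNITUDE FOR THE INTENDED WITNESS (a reading of print, not a proof):
registers `M U e` := print's η-scaled Landau-gauge background potential `ℋ(B(U))(e)` ([Balaban1985Variational] Prop. 9: `U_k = exp(iηℋ(B))`, `B = (1∕i) log V`), size
O(window), no power of `η = L^{−(K−J)}`; (r1) a one-bond move inside `PlaqSmall θ_J` has `|δB_b| ≤ 2θ_J` (a plaquette through `b`), and (190) («decay identical to the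
propagator `H`») gives `‖δM e‖ ≤ C_H e^{−δ_H d_J(b, blk e)}·|δB_b|` per fine bond ⇒ `σ_J := 2C_Hθ_J` (super-poly: `θ_J ≍ p₀ log β_J∕√β_J`, `β_J ≍ βL^J`), `2μ ≤ δ_H`;
(t1) `ℓ_X ≤ 2‖E(X,·)‖_∞∕α₁ ≲ e^{−κd_J(X)}∕α₁`, `K`-uniform ⇒ `A = O(α₁⁻¹)` by the coarse polymer count; (t2) `h_X ≲ e^{−κd_J(X)}∕α₁²` ⇒ two-pin sums `≤ H e^{−κ′d_J(c,c′)}`,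
`2μ ≤ κ′`; (d2) `Σ_{c′} e^{−μ d_J(c,c′)} ≤ C = O(μ⁻³)` — a COARSE count; product check `|Δ_b f| ≤ A·C·σ_J = O(θ_J)` = GRAD∘'s size, no `L^{K−J}` anywhere.  INSTRUMENT GUIDANCE already on file (one loop ∕ classical, L = 2, sides 6–8, float64; proves
nothing): FL-13 (j340232): the background map's one-bond plaquette response is CONFINED (step ratios 0.67, 0.47, 0.043 across the kicked block's shells) down to a
LINEAR (FL-14 (B): θ-independent to 1 %) far-field level ≈ 1.5 % of the local response that wraps the torus TRANSVERSALLY (FL-14 (A)) and halves from side 6 to 8 —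
two sides cannot separate `e^{−m·N}` from a power law, so the row's decay is typed in a TORUS pseudo-metric `d` (wrap-around images are inside `e^{−μd}`) and the
volume-uniform constant `C` is the clause that a power-law floor would break; FL-14 (C): the one-loop functional's collinear∕parallel antipodal mixed differences fall
by ×0.146∕×0.119 per coarse unit of separation (EXP-G), i.e. no floor is inherited by `G` at this resolution.  Cheapest falsifiers: FL-12∕FL-14 (C) type columns
(BGFORM∘ ⇒ GRAD∘ and ⇒ S2β's decay); structurally, a power-law (in the side) far field of the background map's LINEAR response on larger tori (sides 10, 12; FL-15,
prereg 13:37:12Z + amendment A1, running at v2's write) would refute the (r1)∕uniform-`C` pair as typed.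
Sorries = {BGFORM∘ `stub_fluctuationBackgroundFormCan` (NEW, XL)}; 0 elsewhere.  PUBLISHED organ-level line (RULING №36 (3)): NOT registered as the crux item's skeleton.
No summit is proved by a line; `YM3TorusSU2` is NOT proved (S1a, 26243, S2α′, O1 stay open; S2β is proved here only modulo the row); `FluctuationComparisonRegPrIntL`
(20520) is NOT concluded by name by this file; nothing of Bałaban's asserted; rung R3 (YM₃ on T³) — NOT d = 4, NOT infinite volume, NOT a mass gap, NOT Clay.
-/
noncomputable section

open MeasureTheory Filter Topology Set
open Literature.MathematicalPhysics.QuantumFieldTheory.Balaban1983to89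
open Literature.MathematicalPhysics.QuantumFieldTheory.Balaban1983to89.T3ContinuumYM3Torus
open Literature.MathematicalPhysics.QuantumFieldTheory.Balaban1983to89.T3NestedUnitLaws
open Literature.MathematicalPhysics.QuantumFieldTheory.Balaban1983to89.T3UnitLawDensityEML
open Literature.MathematicalPhysics.QuantumFieldTheory.Balaban1983to89.T3UnitScaleTilt
open Literature.MathematicalPhysics.QuantumFieldTheory.Balaban1983to89.T3TiltDescent
open Literature.MathematicalPhysics.QuantumFieldTheory.Balaban1983to89.T3PrintedRegularMinimiser
open Literature.MathematicalPhysics.QuantumFieldTheory.Balaban1983to89.T3ConstrainedMinimiser (fibre)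
open Literature.MathematicalPhysics.QuantumFieldTheory.Balaban1983to89.T3LevelShift
open Literature.MathematicalPhysics.QuantumFieldTheory.Balaban1983to89.Missing
open Literature.MathematicalPhysics.QuantumFieldTheory.Balaban1983to89.T4Continuum

namespace Summit.QuantumFields.YangMills.Cruxes.FluctuationComparisonRegPrIntL.RunPairOrgan.BackgroundForm

/-! ## §0 The TARGETS S2β and GRAD∘ (verbatim, byte-identical) -/

section Rows

/-- **S2β · FLUCTUATION PART SMALL IN 4-POINT CURRENCY** — VERBATIM from the registry `Lines/semiclassical_s2beta.lean` v11.4 §2 (= `Lines/runpair_organ.lean`,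
`Lines/suptail_split.lean` §1, `Lines/gradient_split.lean` §0; version-free: it quantifies over continuous positive versions `ρ`). [cite: Balaban1985UV3, Thm 2 p.263 and (41) p.266] -/
def FluctuationPartSmall : Prop :=
  ∀ (L : ℕ), ∃ pS : ℝ, ∀ (b₀ p₀ : ℝ), 0 < b₀ → pS ≤ p₀ → 0 < p₀ → ∃ ε₁ : ℝ, 0 < ε₁ ∧ ∀ (ε₀ : ℝ), 0 < ε₀ → ε₀ ≤ ε₁ →
    ∃ γ₁ : ℝ, 0 < γ₁ ∧ ∃ κ : ℝ, 0 < κ ∧ ∀ (F : T3Family) (γ : ℝ), F.L = L → 0 < γ → γ ≤ γ₁ →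
      ∃ (φ : ℕ → ℝ), (∀ J, 0 ≤ φ J) ∧ Tendsto (fun J : ℕ => (J : ℝ) * φ J) atTop (𝓝 0) ∧
        ∀ (ν : ℕ → (j : ℕ) → Measure (GaugeField (F.P j) 0 (Matrix.specialUnitaryGroup (Fin 2) ℂ))),
          (∀ K, ν K K = T4GenFunBounds.gibbsMeasure (F.P K) ((F.scheme ℰp γ).β K)) →
          (∀ K j, j < K → ν K j = Measure.map (descend F ℰp j) (ν K (j + 1))) →
          ∀ (J K : ℕ) (hJK : J ≤ K) (ρ : GaugeField (F.P J) 0 (Matrix.specialUnitaryGroup (Fin 2) ℂ) → ℝ),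
            (∀ U, PlaqSmall (θBal F.L γ b₀ p₀ J) U → 0 < ρ U) →
            ν K J = (fieldMeasure _ _ _).withDensity (fun U => ENNReal.ofReal (ρ U)) →
            ContinuousOn ρ {U | PlaqSmall (θBal F.L γ b₀ p₀ J) U} →
            ∀ (b b' : PBond (F.P J) 0) (U V W Z : GaugeField (F.P J) 0 (Matrix.specialUnitaryGroup (Fin 2) ℂ)),
              PlaqSmall (θBal F.L γ b₀ p₀ J) U → PlaqSmall (θBal F.L γ b₀ p₀ J) V →
              PlaqSmall (θBal F.L γ b₀ p₀ J) W → PlaqSmall (θBal F.L γ b₀ p₀ J) Z →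
              (∀ e, e ≠ b → U e = V e) → (∀ e, e ≠ b' → U e = W e) → (∀ e, e ≠ b' → V e = Z e) → (∀ e, e ≠ b → W e = Z e) →
              |((Real.log (ρ U) + (F.scheme ℰp γ).β K * minActionRegPr F J K hJK ε₀ U)
                  - (Real.log (ρ V) + (F.scheme ℰp γ).β K * minActionRegPr F J K hJK ε₀ V))
                - ((Real.log (ρ W) + (F.scheme ℰp γ).β K * minActionRegPr F J K hJK ε₀ W)
                  - (Real.log (ρ Z) + (F.scheme ℰp γ).β K * minActionRegPr F J K hJK ε₀ Z))|
                ≤ φ J * Real.exp (-(κ * (b.src.tdist b'.src : ℝ)))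

/-- **GRAD∘ · ONE-BOND OSCILLATION OF THE FULL FLUCTUATION PART — ALL DEPTHS** — VERBATIM from LINE g24-1 `Lines/gradient_split.lean` §0 (there ★ knit with CRUDELOC
into S2β; LINE g24-2 resolves it through GRAD¹∘ + TAILSUP∘).  Here it is the FIRST-ORDER consequence of BGFORM∘ (Lipschitz terms × one-bond sensitivities × one-pin exchange).
[cite: Balaban1987RG1, Thm 1 (0.24)-(0.25) p.257; Balaban1989LargeFieldII, (1.98)-(1.100) p.390] -/
def OneBondOscillationCan : Prop :=
  ∀ (L : ℕ), ∃ pS : ℝ, ∀ (b₀ p₀ : ℝ), 0 < b₀ → pS ≤ p₀ → 0 < p₀ → ∃ ε₁ : ℝ, 0 < ε₁ ∧ ∀ (ε₀ : ℝ), 0 < ε₀ → ε₀ ≤ ε₁ →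
    ∃ γ₁ : ℝ, 0 < γ₁ ∧ ∀ (F : T3Family) (γ : ℝ), F.L = L → 0 < γ → γ ≤ γ₁ →
      ∃ (σ : ℕ → ℝ), (∀ J, 0 ≤ σ J) ∧ (∀ a : ℕ, Tendsto (fun J : ℕ => ((J : ℝ) + 1) ^ a * σ J) atTop (𝓝 0)) ∧
        ∀ (ν : ℕ → (j : ℕ) → Measure (GaugeField (F.P j) 0 (Matrix.specialUnitaryGroup (Fin 2) ℂ))),
          (∀ K, ν K K = T4GenFunBounds.gibbsMeasure (F.P K) ((F.scheme ℰp γ).β K)) →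
          (∀ K j, j < K → ν K j = Measure.map (descend F ℰp j) (ν K (j + 1))) →
          ∀ (J K : ℕ) (hJK : J ≤ K) (ρ : GaugeField (F.P J) 0 (Matrix.specialUnitaryGroup (Fin 2) ℂ) → ℝ),
            (∀ U, PlaqSmall (θBal F.L γ b₀ p₀ J) U → 0 < ρ U) →
            ν K J = (fieldMeasure _ _ _).withDensity (fun U => ENNReal.ofReal (ρ U)) →
            ContinuousOn ρ {U | PlaqSmall (θBal F.L γ b₀ p₀ J) U} →
            ∀ (b : PBond (F.P J) 0) (U V : GaugeField (F.P J) 0 (Matrix.specialUnitaryGroup (Fin 2) ℂ)),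
              PlaqSmall (θBal F.L γ b₀ p₀ J) U → PlaqSmall (θBal F.L γ b₀ p₀ J) V →
              (∀ e, e ≠ b → U e = V e) →
              |(Real.log (ρ U) + (F.scheme ℰp γ).β K * minActionRegPr F J K hJK ε₀ U)
                  - (Real.log (ρ V) + (F.scheme ℰp γ).β K * minActionRegPr F J K hJK ε₀ V)| ≤ σ J

/-! ## §1 THE ROW: BGFORM∘ (NEW; v2 typing) — background-form representation with coarse-indexed, background-local Lipschitz∕C¹·¹ terms, coarse-lattice counts, and an
exponentially localized per-fine-bond background response -/

/-- **BGFORM∘ · BACKGROUND FORM OF THE FLUCTUATION PART** (`FluctuationBackgroundFormCan`, NEW; print-shaped; size XL = transcription of print's output form +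
ONE cluster-expansion logarithm for the most recent large-field strata).  Frame of S2β (`∃ κ` and the uniform constants `μ, C, A, H` BEFORE `∀ F γ`; the moduli
`σ, σ₂` AFTER `F`, super-polynomially small in `J`, uniform in `K`); for every run `K ≥ J` and every continuous positive window version `ρ` of `ν_{K,J}` there are
(v2 typing): a constant `c₀`; a symmetric pseudo-metric `d` on the COARSE (level-`J`) bonds with `Σ_{c′} e^{−μd(c,c′)} ≤ C` and `κ·tdist_J(b,b′) ≤ μ·d(b,b′)`; a CELL MAP
`blk` from the fine (level-`K`) bonds to the coarse bonds; a BACKGROUND MAP `M` (window field ↦ coordinates `Fin 8 → ℝ` per FINE bond — reading: print's minimal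
configuration `U_k(V)` as the η-scaled potential `ℋ(B)` in the Landau gauge, [Balaban1985Variational] Prop. 9); TERMS `T X` indexed by finite sets `X` of COARSE bonds,
evaluated on `M U`, CELL-SUM LIPSCHITZ in the fine variables of the blocks of `X` (modulus `ℓ X`, one-pin sums `≤ A`; implied by sup-norm Lipschitz) and DISCRETE-C^{1,1}
(modulus `h X`, two-pin sums `≤ H e^{−2μd(c,c′)}`) — reading: `E^{(j)}(X′, ·)` of [Balaban1987RG1] (0.24)–(0.25)
p.257 and `R′^{(k)}(X′, ·)` of [Balaban1989LargeFieldII] (1.98)–(1.100) p.390, analytic on (1.11)–(1.14) p.262, Cauchy; the REPRESENTATION `log ρ U + β_K𝔄^reg U =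
c₀ + Σ_X T X (M U)` on the window; and the per-FINE-bond RESPONSE BOUNDS of `M`: one bond `‖M U e − M V e‖ ≤ σ_J e^{−2μd(b,blk e)}`, mixed two bonds `≤ σ₂,J e^{−2μd(b,blk e)} e^{−2μd(blk e,b′)}`
([Balaban1985Variational] (182)–(190); mixed = analyticity + Cauchy).  v2 (critic #496 P1): every count (`C`, pinned sums) is on the COARSE lattice and `K` enters
no constant; orders of magnitude for the intended witness in the module docstring «v2».  REMARK (BGFORM∘ is weaker than POLY∘ of LINE g24-3): informally `M U e` := the
coordinates of `U (blk e)`, `T X` := POLY∘'s `T_X` read through any section of `blk`, `d` := `D·[x ≠ y]` with `D ≥ κ·diam`, `h := 0`, `σ_J` := the window's one-bond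
diameter; not formalised here, recorded on the card.
WHY IT MIGHT FAIL: (a) last Mayer step (load-bearing); (b) dictionary; (c) moduli = (0.25) + analyticity + Cauchy, corollary; (d) torons; (f) product-kernel shape of
the mixed response is the Cauchy shape, not printed; (g) GAUGE ∕ CHART: `M`, `blk`, `d` are ANY maps — print-faithfulness is a reading, register charts stay admissible.
STRONGER than S2β and than GRAD∘; WEAKER than POLY∘;
does NOT imply 20520 or `YM3TorusSU2` (BC2∕BC7 on the card).
[cite: Balaban1985Variational, Prop. 9 p.309, (182)-(190) pp.307-308; Balaban1987RG1, (0.22)-(0.25) pp.256-257, Thm 1 p.259; Balaban1989LargeFieldII, (1.98)-(1.100) p.390; Balaban1985UV3, Thm 2 p.263] -/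
def FluctuationBackgroundFormCan : Prop :=
  ∀ (L : ℕ), ∃ pS : ℝ, ∀ (b₀ p₀ : ℝ), 0 < b₀ → pS ≤ p₀ → 0 < p₀ → ∃ ε₁ : ℝ, 0 < ε₁ ∧ ∀ (ε₀ : ℝ), 0 < ε₀ → ε₀ ≤ ε₁ →
    ∃ γ₁ : ℝ, 0 < γ₁ ∧ ∃ (κ μ C A Hc : ℝ), 0 < κ ∧ 0 ≤ μ ∧ 0 ≤ A ∧ 0 ≤ Hc ∧ ∀ (F : T3Family) (γ : ℝ), F.L = L → 0 < γ → γ ≤ γ₁ →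
      ∃ (σ σ₂ : ℕ → ℝ), (∀ J, 0 ≤ σ J) ∧ (∀ J, 0 ≤ σ₂ J) ∧
        (∀ a : ℕ, Tendsto (fun J : ℕ => ((J : ℝ) + 1) ^ a * σ J) atTop (𝓝 0)) ∧
        (∀ a : ℕ, Tendsto (fun J : ℕ => ((J : ℝ) + 1) ^ a * σ₂ J) atTop (𝓝 0)) ∧
        ∀ (ν : ℕ → (j : ℕ) → Measure (GaugeField (F.P j) 0 (Matrix.specialUnitaryGroup (Fin 2) ℂ))),
          (∀ K, ν K K = T4GenFunBounds.gibbsMeasure (F.P K) ((F.scheme ℰp γ).β K)) →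
          (∀ K j, j < K → ν K j = Measure.map (descend F ℰp j) (ν K (j + 1))) →
          ∀ (J K : ℕ) (hJK : J ≤ K) (ρ : GaugeField (F.P J) 0 (Matrix.specialUnitaryGroup (Fin 2) ℂ) → ℝ),
            (∀ U, PlaqSmall (θBal F.L γ b₀ p₀ J) U → 0 < ρ U) →
            ν K J = (fieldMeasure _ _ _).withDensity (fun U => ENNReal.ofReal (ρ U)) →
            ContinuousOn ρ {U | PlaqSmall (θBal F.L γ b₀ p₀ J) U} →
            ∃ (c₀ : ℝ) (d : PBond (F.P J) 0 → PBond (F.P J) 0 → ℝ) (blk : PBond (F.P K) 0 → PBond (F.P J) 0)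
              (M : GaugeField (F.P J) 0 (Matrix.specialUnitaryGroup (Fin 2) ℂ) → PBond (F.P K) 0 → (Fin 8 → ℝ))
              (T : Finset (PBond (F.P J) 0) → (PBond (F.P K) 0 → (Fin 8 → ℝ)) → ℝ)
              (ℓ h : Finset (PBond (F.P J) 0) → ℝ),
              (∀ x y, 0 ≤ d x y) ∧ (∀ x y, d x y = d y x) ∧ (∀ x y z, d x z ≤ d x y + d y z) ∧
              (∀ x, ∑ y, Real.exp (-(μ * d x y)) ≤ C) ∧
              (∀ b b' : PBond (F.P J) 0, κ * (b.src.tdist b'.src : ℝ) ≤ μ * d b b') ∧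
              (∀ X, 0 ≤ ℓ X) ∧ (∀ X, 0 ≤ h X) ∧
              (∀ c, ∑ X ∈ Finset.univ.filter (fun X => c ∈ X), ℓ X ≤ A) ∧
              (∀ c c', ∑ X ∈ Finset.univ.filter (fun X => c ∈ X ∧ c' ∈ X), h X ≤ Hc * Real.exp (-(2 * μ * d c c'))) ∧
              (∀ (X : Finset (PBond (F.P J) 0)) (U V : GaugeField (F.P J) 0 (Matrix.specialUnitaryGroup (Fin 2) ℂ)),
                  PlaqSmall (θBal F.L γ b₀ p₀ J) U → PlaqSmall (θBal F.L γ b₀ p₀ J) V →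
                  ∀ (S₁ : PBond (F.P J) 0 → ℝ), (∀ c, 0 ≤ S₁ c) →
                  (∀ e, blk e ∈ X → ‖M U e - M V e‖ ≤ S₁ (blk e)) →
                  |T X (M U) - T X (M V)| ≤ ℓ X * ∑ c ∈ X, S₁ c) ∧
              (∀ (X : Finset (PBond (F.P J) 0)) (U V W Z : GaugeField (F.P J) 0 (Matrix.specialUnitaryGroup (Fin 2) ℂ)),
                  PlaqSmall (θBal F.L γ b₀ p₀ J) U → PlaqSmall (θBal F.L γ b₀ p₀ J) V →
                  PlaqSmall (θBal F.L γ b₀ p₀ J) W → PlaqSmall (θBal F.L γ b₀ p₀ J) Z →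
                  ∀ (S₁ S₂ S₁₂ : PBond (F.P J) 0 → ℝ), (∀ c, 0 ≤ S₁ c) → (∀ c, 0 ≤ S₂ c) → (∀ c, 0 ≤ S₁₂ c) →
                  (∀ e, blk e ∈ X → ‖M W e - M Z e‖ ≤ S₁ (blk e)) →
                  (∀ e, blk e ∈ X → ‖M V e - M Z e‖ ≤ S₂ (blk e)) →
                  (∀ e, blk e ∈ X → ‖M U e - M W e - M V e + M Z e‖ ≤ S₁₂ (blk e)) →
                  |T X (M U) - T X (M W) - T X (M V) + T X (M Z)| ≤
                    h X * (∑ c ∈ X, S₁ c) * (∑ c ∈ X, S₂ c) + ℓ X * ∑ c ∈ X, S₁₂ c) ∧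
              (∀ (b : PBond (F.P J) 0) (U V : GaugeField (F.P J) 0 (Matrix.specialUnitaryGroup (Fin 2) ℂ)),
                  PlaqSmall (θBal F.L γ b₀ p₀ J) U → PlaqSmall (θBal F.L γ b₀ p₀ J) V → (∀ e, e ≠ b → U e = V e) →
                  ∀ e, ‖M U e - M V e‖ ≤ σ J * Real.exp (-(2 * μ * d b (blk e)))) ∧
              (∀ (b b' : PBond (F.P J) 0) (U V W Z : GaugeField (F.P J) 0 (Matrix.specialUnitaryGroup (Fin 2) ℂ)),
                  PlaqSmall (θBal F.L γ b₀ p₀ J) U → PlaqSmall (θBal F.L γ b₀ p₀ J) V →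
                  PlaqSmall (θBal F.L γ b₀ p₀ J) W → PlaqSmall (θBal F.L γ b₀ p₀ J) Z →
                  (∀ e, e ≠ b → U e = V e) → (∀ e, e ≠ b' → U e = W e) → (∀ e, e ≠ b' → V e = Z e) → (∀ e, e ≠ b → W e = Z e) →
                  ∀ e, ‖M U e - M W e - M V e + M Z e‖ ≤
                    σ₂ J * (Real.exp (-(2 * μ * d b (blk e))) * Real.exp (-(2 * μ * d (blk e) b')))) ∧
              (∀ U : GaugeField (F.P J) 0 (Matrix.specialUnitaryGroup (Fin 2) ℂ), PlaqSmall (θBal F.L γ b₀ p₀ J) U →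
                  Real.log (ρ U) + (F.scheme ℰp γ).β K * minActionRegPr F J K hJK ε₀ U = c₀ + ∑ X, T X (M U))

end Rows

/-! ## §2 PROVED: the sensitivity algebra (cell form of the toolkit `Lines/background_form_algebra.lean` 16a43cd95c52e6a8 §1; §2 inlined verbatim), two exponential convolutions,
super-polynomial bookkeeping -/

section AlgebraA

variable {ι G H 𝓒 E : Type*} [Fintype 𝓒] [NormedAddCommGroup H]

/-- **First order (cell form).** One-bond oscillation of `f = c₀ + Σ_X T X ∘ M` (terms indexed by finite sets `X` of COARSE cells, registers on FINE bonds `e`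
with cell map `blk`) from cell-sum Lipschitz moduli of the terms and a cellwise bound `s (blk e)` on the one-bond response of the background map. -/
theorem oneBond_le_of_cellLipschitz
    (blk : E → 𝓒) (T : Finset 𝓒 → (E → H) → ℝ) (ℓ : Finset 𝓒 → ℝ) (M : (ι → G) → (E → H))
    (S : Set (ι → G)) (c₀ : ℝ) (f : (ι → G) → ℝ) (s : 𝓒 → ℝ) (hs : ∀ c, 0 ≤ s c)
    (hlip : ∀ X V V', V ∈ S → V' ∈ S → ∀ S₁ : 𝓒 → ℝ, (∀ c, 0 ≤ S₁ c) → (∀ e, blk e ∈ X → ‖M V e - M V' e‖ ≤ S₁ (blk e)) →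
      |T X (M V) - T X (M V')| ≤ ℓ X * ∑ c ∈ X, S₁ c)
    (hrep : ∀ V, V ∈ S → f V = c₀ + ∑ X, T X (M V))
    (V V' : ι → G) (hV : V ∈ S) (hV' : V' ∈ S)
    (hsens : ∀ e, ‖M V e - M V' e‖ ≤ s (blk e)) :
    |f V - f V'| ≤ ∑ X, ℓ X * ∑ c ∈ X, s c := by
  have hdiff : f V - f V' = ∑ X, (T X (M V) - T X (M V')) := by
    rw [hrep V hV, hrep V' hV', Finset.sum_sub_distrib]; ring
  rw [hdiff]
  refine (Finset.abs_sum_le_sum_abs _ _).trans (Finset.sum_le_sum fun X _ => ?_)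
  exact hlip X V V' hV hV' s hs (fun e _ => hsens e)

/-- **Second order (cell form).** The connected four-point difference of `f = c₀ + Σ_X T X ∘ M` over a square of window data
(`V₁₀` = `V₀₀` moved at `b`, `V₀₁` = `V₀₀` moved at `b'`, `V₁₁` = both) from cell-sum discrete-C^{1,1} moduli of the terms and cellwise bounds on the first- and
mixed second-order response of the background map. -/
theorem fourPoint_le_of_cellC11
    (blk : E → 𝓒) (T : Finset 𝓒 → (E → H) → ℝ) (ℓ h : Finset 𝓒 → ℝ) (M : (ι → G) → (E → H))
    (S : Set (ι → G)) (c₀ : ℝ) (f : (ι → G) → ℝ) (s s' s₂ : 𝓒 → ℝ)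
    (hs : ∀ c, 0 ≤ s c) (hs' : ∀ c, 0 ≤ s' c) (hs₂ : ∀ c, 0 ≤ s₂ c)
    (hC11 : ∀ X V₀₀ V₁₀ V₀₁ V₁₁, V₀₀ ∈ S → V₁₀ ∈ S → V₀₁ ∈ S → V₁₁ ∈ S →
      ∀ S₁ S₂ S₁₂ : 𝓒 → ℝ, (∀ c, 0 ≤ S₁ c) → (∀ c, 0 ≤ S₂ c) → (∀ c, 0 ≤ S₁₂ c) →
      (∀ e, blk e ∈ X → ‖M V₁₀ e - M V₀₀ e‖ ≤ S₁ (blk e)) →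
      (∀ e, blk e ∈ X → ‖M V₀₁ e - M V₀₀ e‖ ≤ S₂ (blk e)) →
      (∀ e, blk e ∈ X → ‖M V₁₁ e - M V₁₀ e - M V₀₁ e + M V₀₀ e‖ ≤ S₁₂ (blk e)) →
      |T X (M V₁₁) - T X (M V₁₀) - T X (M V₀₁) + T X (M V₀₀)| ≤
        h X * (∑ c ∈ X, S₁ c) * (∑ c ∈ X, S₂ c) + ℓ X * ∑ c ∈ X, S₁₂ c)
    (hrep : ∀ V, V ∈ S → f V = c₀ + ∑ X, T X (M V))
    (V₀₀ V₁₀ V₀₁ V₁₁ : ι → G) (h₀₀ : V₀₀ ∈ S) (h₁₀ : V₁₀ ∈ S) (h₀₁ : V₀₁ ∈ S) (h₁₁ : V₁₁ ∈ S)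
    (hsens₁ : ∀ e, ‖M V₁₀ e - M V₀₀ e‖ ≤ s (blk e)) (hsens₂ : ∀ e, ‖M V₀₁ e - M V₀₀ e‖ ≤ s' (blk e))
    (hsens₁₂ : ∀ e, ‖M V₁₁ e - M V₁₀ e - M V₀₁ e + M V₀₀ e‖ ≤ s₂ (blk e)) :
    |f V₁₁ - f V₁₀ - f V₀₁ + f V₀₀| ≤
      ∑ X, (h X * (∑ c ∈ X, s c) * (∑ c ∈ X, s' c) + ℓ X * ∑ c ∈ X, s₂ c) := by
  have hdiff : f V₁₁ - f V₁₀ - f V₀₁ + f V₀₀ =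
      ∑ X, (T X (M V₁₁) - T X (M V₁₀) - T X (M V₀₁) + T X (M V₀₀)) := by
    rw [hrep _ h₁₁, hrep _ h₁₀, hrep _ h₀₁, hrep _ h₀₀]
    simp only [Finset.sum_add_distrib, Finset.sum_sub_distrib]; ring
  rw [hdiff]
  refine (Finset.abs_sum_le_sum_abs _ _).trans (Finset.sum_le_sum fun X _ => ?_)
  exact hC11 X V₀₀ V₁₀ V₀₁ V₁₁ h₀₀ h₁₀ h₀₁ h₁₁ s s' s₂ hs hs' hs₂ (fun e _ => hsens₁ e) (fun e _ => hsens₂ e) (fun e _ => hsens₁₂ e)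

/-- The S2β-shaped corollary: with `U := V₁₁, V := V₀₁, W := V₁₀, Z := V₀₀` the square's connected difference is `(f U − f V) − (f W − f Z)`. -/
theorem fourPoint_rearrange (f : (ι → G) → ℝ) (V₀₀ V₁₀ V₀₁ V₁₁ : ι → G) :
    (f V₁₁ - f V₀₁) - (f V₁₀ - f V₀₀) = f V₁₁ - f V₁₀ - f V₀₁ + f V₀₀ := by ring


end AlgebraA

section AlgebraB

variable {E 𝓧 : Type*} [Fintype E] [Fintype 𝓧]

/-- **One-pin exchange.** `Σ_X ℓ X · Σ_{e ∈ supp X} s e = Σ_e s e · Σ_{X : e ∈ supp X} ℓ X`; hence pinned sums `≤ A` and `Σ_e s e ≤ B` bound the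
first-order right-hand side of `oneBond_le_of_sensitivity` by `A · B`. -/
theorem sum_mul_sum_supp_le [DecidableEq E] (supp : 𝓧 → Finset E) (ℓ : 𝓧 → ℝ) (s : E → ℝ) (A B : ℝ)
    (hs : ∀ e, 0 ≤ s e)
    (hpin : ∀ e, ∑ X ∈ Finset.univ.filter (fun X => e ∈ supp X), ℓ X ≤ A)
    (hB : ∑ e, s e ≤ B) (hA : 0 ≤ A) :
    ∑ X, ℓ X * ∑ e ∈ supp X, s e ≤ A * B := by
  classical
  have hex : ∑ X, ℓ X * ∑ e ∈ supp X, s e = ∑ e, s e * ∑ X ∈ Finset.univ.filter (fun X => e ∈ supp X), ℓ X := by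
    simp_rw [Finset.mul_sum]
    rw [Finset.sum_comm' (s' := fun e => Finset.univ.filter (fun X => e ∈ supp X)) (t' := Finset.univ)]
    · exact Finset.sum_congr rfl fun e _ => Finset.sum_congr rfl fun X _ => mul_comm _ _
    · intro X e; simp
  rw [hex]
  calc ∑ e, s e * ∑ X ∈ Finset.univ.filter (fun X => e ∈ supp X), ℓ X
      ≤ ∑ e, s e * A := Finset.sum_le_sum fun e _ => mul_le_mul_of_nonneg_left (hpin e) (hs e)
    _ = (∑ e, s e) * A := (Finset.sum_mul _ _ _).symm
    _ ≤ B * A := mul_le_mul_of_nonneg_right hB hA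
    _ = A * B := mul_comm _ _

/-- **Two-pin exchange.** `Σ_X h X · (Σ_{e ∈ supp X} s e)(Σ_{e' ∈ supp X} t e') = Σ_{e,e'} s e · t e' · Σ_{X : e, e' ∈ supp X} h X`, so two-pinned bounds
`Σ_{X ∋ e,e'} h X ≤ K e e'` give `≤ Σ_{e,e'} s e · t e' · K e e'` (nonnegative weights). -/
theorem sum_mul_sum_mul_sum_supp_le [DecidableEq E] (supp : 𝓧 → Finset E) (h : 𝓧 → ℝ) (s t : E → ℝ) (K : E → E → ℝ)
    (hs : ∀ e, 0 ≤ s e) (ht : ∀ e, 0 ≤ t e)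
    (hpin : ∀ e e', ∑ X ∈ Finset.univ.filter (fun X => e ∈ supp X ∧ e' ∈ supp X), h X ≤ K e e') :
    ∑ X, h X * (∑ e ∈ supp X, s e) * (∑ e' ∈ supp X, t e') ≤ ∑ e, ∑ e', s e * t e' * K e e' := by
  classical
  have h1 : ∀ X, h X * (∑ e ∈ supp X, s e) * (∑ e' ∈ supp X, t e') = ∑ e ∈ supp X, ∑ e' ∈ supp X, s e * t e' * h X := by
    intro X
    rw [Finset.mul_sum (supp X) s (h X), Finset.sum_mul (supp X) (fun e => h X * s e)]
    refine Finset.sum_congr rfl fun e _ => ?_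
    rw [Finset.mul_sum]
    exact Finset.sum_congr rfl fun e' _ => by ring
  have hex : ∑ X, h X * (∑ e ∈ supp X, s e) * (∑ e' ∈ supp X, t e') =
      ∑ e, ∑ e', s e * t e' * ∑ X ∈ Finset.univ.filter (fun X => e ∈ supp X ∧ e' ∈ supp X), h X := by
    simp_rw [h1]
    rw [Finset.sum_comm' (s' := fun e => Finset.univ.filter (fun X => e ∈ supp X)) (t' := Finset.univ)]
    swap
    · intro X e; simp
    refine Finset.sum_congr rfl fun e _ => ?_
    rw [Finset.sum_comm' (s' := fun e' => Finset.univ.filter (fun X => e ∈ supp X ∧ e' ∈ supp X)) (t' := Finset.univ)]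
    swap
    · intro X e'; simp
    refine Finset.sum_congr rfl fun e' _ => ?_
    rw [Finset.mul_sum]
  rw [hex]
  refine Finset.sum_le_sum fun e _ => Finset.sum_le_sum fun e' _ => ?_
  exact mul_le_mul_of_nonneg_left (hpin e e') (mul_nonneg (hs e) (ht e'))

/-- **Exponential convolution through the triangle inequality.** On a finite index with a pseudo-distance `d` (nonnegative, triangle inequality) and
a uniform summability constant `C` for the kernel `e^{−μ d(x,·)}`: `Σ_{e,e'} e^{−2μ d(b,e)} e^{−2μ d(e,e')} e^{−2μ d(e',b')} ≤ C² · e^{−μ d(b,b')}`. -/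
theorem exp_convolution_le (d : E → E → ℝ) (μ C : ℝ) (hμ : 0 ≤ μ) (hd : ∀ x y, 0 ≤ d x y)
    (htri : ∀ x y z, d x z ≤ d x y + d y z)
    (hsum : ∀ x, ∑ y, Real.exp (-(μ * d x y)) ≤ C) (b b' : E) :
    ∑ e, ∑ e', Real.exp (-(2 * μ * d b e)) * Real.exp (-(2 * μ * d e e')) * Real.exp (-(2 * μ * d e' b')) ≤
      C ^ 2 * Real.exp (-(μ * d b b')) := by
  have hC : 0 ≤ C := le_trans (Finset.sum_nonneg fun y _ => (Real.exp_pos _).le) (hsum b)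
  have hpt : ∀ e e', Real.exp (-(2 * μ * d b e)) * Real.exp (-(2 * μ * d e e')) * Real.exp (-(2 * μ * d e' b')) ≤
      Real.exp (-(μ * d b b')) * (Real.exp (-(μ * d b e)) * Real.exp (-(μ * d e e'))) := by
    intro e e'
    have htri' : d b b' ≤ d b e + d e e' + d e' b' := by
      have h₁ := htri b e b'; have h₂ := htri e e' b'; linarith
    rw [← Real.exp_add, ← Real.exp_add, ← Real.exp_add, ← Real.exp_add, Real.exp_le_exp]
    have h1 := mul_le_mul_of_nonneg_left htri' hμ
    have h2 := mul_nonneg hμ (hd e' b')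
    have h3 := mul_nonneg hμ (hd b e)
    have h4 := mul_nonneg hμ (hd e e')
    nlinarith
  calc ∑ e, ∑ e', Real.exp (-(2 * μ * d b e)) * Real.exp (-(2 * μ * d e e')) * Real.exp (-(2 * μ * d e' b'))
      ≤ ∑ e, ∑ e', Real.exp (-(μ * d b b')) * (Real.exp (-(μ * d b e)) * Real.exp (-(μ * d e e'))) :=
        Finset.sum_le_sum fun e _ => Finset.sum_le_sum fun e' _ => hpt e e'
    _ = Real.exp (-(μ * d b b')) * ∑ e, Real.exp (-(μ * d b e)) * ∑ e', Real.exp (-(μ * d e e')) := by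
        rw [Finset.mul_sum]; refine Finset.sum_congr rfl fun e _ => ?_; rw [Finset.mul_sum, Finset.mul_sum]
    _ ≤ Real.exp (-(μ * d b b')) * ∑ e, Real.exp (-(μ * d b e)) * C := by
        refine mul_le_mul_of_nonneg_left (Finset.sum_le_sum fun e _ => ?_) (Real.exp_pos _).le
        exact mul_le_mul_of_nonneg_left (hsum e) (Real.exp_pos _).le
    _ = Real.exp (-(μ * d b b')) * ((∑ e, Real.exp (-(μ * d b e))) * C) := by rw [Finset.sum_mul]
    _ ≤ Real.exp (-(μ * d b b')) * (C * C) :=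
        mul_le_mul_of_nonneg_left (mul_le_mul_of_nonneg_right (hsum b) hC) (Real.exp_pos _).le
    _ = C ^ 2 * Real.exp (-(μ * d b b')) := by ring


/-- Two-factor exponential convolution: `Σ_e e^{−2μ d(x,e)} e^{−2μ d(e,y)} ≤ C · e^{−μ d(x,y)}`. -/
theorem exp_convolution_two_le (d : E → E → ℝ) (μ C : ℝ) (hμ : 0 ≤ μ) (hd : ∀ x y, 0 ≤ d x y)
    (htri : ∀ x y z, d x z ≤ d x y + d y z)
    (hsum : ∀ x, ∑ y, Real.exp (-(μ * d x y)) ≤ C) (x y : E) :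
    ∑ e, Real.exp (-(2 * μ * d x e)) * Real.exp (-(2 * μ * d e y)) ≤ C * Real.exp (-(μ * d x y)) := by
  have hpt : ∀ e, Real.exp (-(2 * μ * d x e)) * Real.exp (-(2 * μ * d e y)) ≤
      Real.exp (-(μ * d x e)) * Real.exp (-(μ * d x y)) := by
    intro e
    rw [← Real.exp_add, ← Real.exp_add, Real.exp_le_exp]
    have h1 := mul_le_mul_of_nonneg_left (htri x e y) hμ
    have h2 := mul_nonneg hμ (hd x e)
    have h3 := mul_nonneg hμ (hd e y)
    nlinarith
  calc ∑ e, Real.exp (-(2 * μ * d x e)) * Real.exp (-(2 * μ * d e y))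
      ≤ ∑ e, Real.exp (-(μ * d x e)) * Real.exp (-(μ * d x y)) := Finset.sum_le_sum fun e _ => hpt e
    _ = (∑ e, Real.exp (-(μ * d x e))) * Real.exp (-(μ * d x y)) := (Finset.sum_mul _ _ _).symm
    _ ≤ C * Real.exp (-(μ * d x y)) := mul_le_mul_of_nonneg_right (hsum x) (Real.exp_pos _).le

/-- Halving the rate only increases the kernel. -/
theorem exp_two_mul_le (μ t : ℝ) (hμ : 0 ≤ μ) (ht : 0 ≤ t) : Real.exp (-(2 * μ * t)) ≤ Real.exp (-(μ * t)) := by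
  rw [Real.exp_le_exp]; nlinarith [mul_nonneg hμ ht]

end AlgebraB

section Superpoly

/-- A nonnegative super-polynomially small sequence tends to `0`. -/
theorem tendsto_zero_of_superpoly {σ : ℕ → ℝ}
    (hσ : ∀ a : ℕ, Tendsto (fun J : ℕ => ((J : ℝ) + 1) ^ a * σ J) atTop (𝓝 0)) :
    Tendsto σ atTop (𝓝 0) := by
  simpa using hσ 0

/-- … and so does `J · σ_J`. -/
theorem tendsto_mul_of_superpoly {σ : ℕ → ℝ} (hσ0 : ∀ J, 0 ≤ σ J)
    (hσ : ∀ a : ℕ, Tendsto (fun J : ℕ => ((J : ℝ) + 1) ^ a * σ J) atTop (𝓝 0)) :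
    Tendsto (fun J : ℕ => (J : ℝ) * σ J) atTop (𝓝 0) := by
  have h1 : Tendsto (fun J : ℕ => ((J : ℝ) + 1) ^ 1 * σ J) atTop (𝓝 0) := hσ 1
  refine tendsto_of_tendsto_of_tendsto_of_le_of_le tendsto_const_nhds h1 (fun J => ?_) (fun J => ?_)
  · exact mul_nonneg (Nat.cast_nonneg J) (hσ0 J)
  · have := hσ0 J
    have hJ : (0 : ℝ) ≤ J := Nat.cast_nonneg J
    simp only [pow_one]
    nlinarith

/-- The S2β modulus manufactured from the response moduli: `J · (H C² σ_J² + A C σ₂,J) → 0`. -/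
theorem tendsto_phi_of_superpoly {σ σ₂ : ℕ → ℝ} (Hc C A : ℝ) (hσ0 : ∀ J, 0 ≤ σ J) (hσ₂0 : ∀ J, 0 ≤ σ₂ J)
    (hσ : ∀ a : ℕ, Tendsto (fun J : ℕ => ((J : ℝ) + 1) ^ a * σ J) atTop (𝓝 0))
    (hσ₂ : ∀ a : ℕ, Tendsto (fun J : ℕ => ((J : ℝ) + 1) ^ a * σ₂ J) atTop (𝓝 0)) :
    Tendsto (fun J : ℕ => (J : ℝ) * (Hc * C ^ 2 * σ J ^ 2 + A * C * σ₂ J)) atTop (𝓝 0) := by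
  have h1 : Tendsto (fun J : ℕ => Hc * C ^ 2 * (((J : ℝ) * σ J) * σ J)) atTop (𝓝 0) := by
    have := ((tendsto_mul_of_superpoly hσ0 hσ).mul (tendsto_zero_of_superpoly hσ)).const_mul (Hc * C ^ 2)
    simpa using this
  have h2 : Tendsto (fun J : ℕ => A * C * ((J : ℝ) * σ₂ J)) atTop (𝓝 0) := by
    have := (tendsto_mul_of_superpoly hσ₂0 hσ₂).const_mul (A * C)
    simpa using this
  have h := h1.add h2
  simp only [add_zero] at h
  exact Tendsto.congr (fun J => by ring) h

/-- The GRAD∘ modulus `A · C · σ_J` is super-polynomially small. -/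
theorem superpoly_const_mul {σ : ℕ → ℝ} (c : ℝ)
    (hσ : ∀ a : ℕ, Tendsto (fun J : ℕ => ((J : ℝ) + 1) ^ a * σ J) atTop (𝓝 0)) :
    ∀ a : ℕ, Tendsto (fun J : ℕ => ((J : ℝ) + 1) ^ a * (c * σ J)) atTop (𝓝 0) := by
  intro a
  have := (hσ a).const_mul c
  simp only [mul_zero] at this
  exact Tendsto.congr (fun J => by ring) this

end Superpoly

/-! ## §3 PROVED: BGFORM∘ → GRAD∘ and BGFORM∘ → S2β -/

section Junctions

/-- The suffices-statement of the line. -/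
def BackgroundFormSuffices : Prop := FluctuationBackgroundFormCan → FluctuationPartSmall

/-- ★ BGFORM∘ → GRAD∘: Lipschitz terms × one-bond response × one-pin exchange; `σ^{GRAD}_J := A·C·σ_J`. -/
theorem oneBondOscillation_of_backgroundForm (hB : FluctuationBackgroundFormCan) : OneBondOscillationCan := by
  intro L
  obtain ⟨pS, HpS⟩ := hB L
  refine ⟨pS, ?_⟩
  intro b₀ p₀ hb₀ hpS hp₀
  obtain ⟨ε₁, hε₁, Hε⟩ := HpS b₀ p₀ hb₀ hpS hp₀
  refine ⟨ε₁, hε₁, ?_⟩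
  intro ε₀ hε₀ hε₀₁
  obtain ⟨γ₁, hγ₁, κ, μ, C, A, Hc, _hκ, hμ, hA, _hHc, HF⟩ := Hε ε₀ hε₀ hε₀₁
  refine ⟨γ₁, hγ₁, ?_⟩
  intro F γ hFL hγ hγ₁'
  obtain ⟨σ, σ₂, hσ0, _hσ₂0, hσ, _hσ₂, Hν⟩ := HF F γ hFL hγ hγ₁'
  refine ⟨fun J => A * max C 0 * σ J, fun J => mul_nonneg (mul_nonneg hA (le_max_right _ _)) (hσ0 J),
    superpoly_const_mul (A * max C 0) hσ, ?_⟩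
  intro ν hνK hνd J K hJK ρ hρpos hρν hρcont b U V hU hV hUV
  obtain ⟨c₀, d, blk, M, T, ℓ, h, hd0, _hdsym, _hdtri, hdsum, _hdcmp, hℓ0, _hh0, hpin1, _hpin2, hlip, _hC11, hsens1, _hsens2, hrep⟩ :=
    Hν ν hνK hνd J K hJK ρ hρpos hρν hρcont
  set S : Set (GaugeField (F.P J) 0 (Matrix.specialUnitaryGroup (Fin 2) ℂ)) := {U | PlaqSmall (θBal F.L γ b₀ p₀ J) U} with hS
  have hs0 : ∀ c : PBond (F.P J) 0, 0 ≤ σ J * Real.exp (-(2 * μ * d b c)) := fun c => mul_nonneg (hσ0 J) (Real.exp_pos _).le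
  have key := oneBond_le_of_cellLipschitz blk T ℓ M S c₀
    (fun U => Real.log (ρ U) + (F.scheme ℰp γ).β K * minActionRegPr F J K hJK ε₀ U)
    (fun (c : PBond (F.P J) 0) => σ J * Real.exp (-(2 * μ * d b c))) hs0
    (fun X U' V' hU' hV' S₁ hS₁ hb => hlip X U' V' hU' hV' S₁ hS₁ hb)
    (fun V hV => hrep V hV) U V hU hV (hsens1 b U V hU hV hUV)
  refine key.trans ?_
  have hC0 : 0 ≤ max C 0 := le_max_right _ _
  have hB : ∑ c, σ J * Real.exp (-(2 * μ * d b c)) ≤ σ J * max C 0 := by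
    rw [← Finset.mul_sum]
    refine mul_le_mul_of_nonneg_left ?_ (hσ0 J)
    calc ∑ c, Real.exp (-(2 * μ * d b c)) ≤ ∑ c, Real.exp (-(μ * d b c)) :=
          Finset.sum_le_sum fun c _ => exp_two_mul_le μ _ hμ (hd0 _ _)
      _ ≤ C := hdsum b
      _ ≤ max C 0 := le_max_left _ _
  have := sum_mul_sum_supp_le (fun X : Finset (PBond (F.P J) 0) => X) ℓ
    (fun c => σ J * Real.exp (-(2 * μ * d b c))) A (σ J * max C 0)
    hs0 hpin1 hB hA
  calc ∑ X, ℓ X * ∑ c ∈ X, σ J * Real.exp (-(2 * μ * d b c)) ≤ A * (σ J * max C 0) := this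
    _ = A * max C 0 * σ J := by ring

/-- ★ BGFORM∘ → S2β: C^{1,1} terms × first- and mixed second-order response × two-pin exchange × exponential convolutions;
`κ_{S2β} := κ`, `φ_J := H·C′²·σ_J² + A·C′·σ₂,J` (`C′ = max C 0`). -/
theorem fluctuationPartSmall_of_backgroundForm : BackgroundFormSuffices := by
  intro hB L
  obtain ⟨pS, HpS⟩ := hB L
  refine ⟨pS, ?_⟩
  intro b₀ p₀ hb₀ hpS hp₀
  obtain ⟨ε₁, hε₁, Hε⟩ := HpS b₀ p₀ hb₀ hpS hp₀
  refine ⟨ε₁, hε₁, ?_⟩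
  intro ε₀ hε₀ hε₀₁
  obtain ⟨γ₁, hγ₁, κ, μ, C, A, Hc, hκ, hμ, hA, hHc, HF⟩ := Hε ε₀ hε₀ hε₀₁
  refine ⟨γ₁, hγ₁, κ, hκ, ?_⟩
  intro F γ hFL hγ hγ₁'
  obtain ⟨σ, σ₂, hσ0, hσ₂0, hσ, hσ₂, Hν⟩ := HF F γ hFL hγ hγ₁'
  set C' : ℝ := max C 0 with hC'
  have hC'0 : 0 ≤ C' := le_max_right _ _
  refine ⟨fun J => Hc * C' ^ 2 * σ J ^ 2 + A * C' * σ₂ J,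
    fun J => add_nonneg (mul_nonneg (mul_nonneg hHc (sq_nonneg _)) (sq_nonneg _)) (mul_nonneg (mul_nonneg hA hC'0) (hσ₂0 J)),
    tendsto_phi_of_superpoly Hc C' A hσ0 hσ₂0 hσ hσ₂, ?_⟩
  intro ν hνK hνd J K hJK ρ hρpos hρν hρcont b b' U V W Z hU hV hW hZ hUV hUW hVZ hWZ
  obtain ⟨c₀, d, blk, M, T, ℓ, h, hd0, hdsym, hdtri, hdsum, hdcmp, hℓ0, hh0, hpin1, hpin2, hlip, hC11, hsens1, hsens2, hrep⟩ :=
    Hν ν hνK hνd J K hJK ρ hρpos hρν hρcont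
  have hdsum' : ∀ x, ∑ y, Real.exp (-(μ * d x y)) ≤ C' := fun x => (hdsum x).trans (le_max_left _ _)
  set S : Set (GaugeField (F.P J) 0 (Matrix.specialUnitaryGroup (Fin 2) ℂ)) := {U | PlaqSmall (θBal F.L γ b₀ p₀ J) U} with hS
  set f : GaugeField (F.P J) 0 (Matrix.specialUnitaryGroup (Fin 2) ℂ) → ℝ :=
    fun U => Real.log (ρ U) + (F.scheme ℰp γ).β K * minActionRegPr F J K hJK ε₀ U with hf
  set s : PBond (F.P J) 0 → PBond (F.P J) 0 → ℝ := fun b c => σ J * Real.exp (-(2 * μ * d b c)) with hs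
  set s₂ : PBond (F.P J) 0 → ℝ := fun c => σ₂ J * (Real.exp (-(2 * μ * d b c)) * Real.exp (-(2 * μ * d c b'))) with hs₂
  have hs0 : ∀ b c, 0 ≤ s b c := fun b c => mul_nonneg (hσ0 J) (Real.exp_pos _).le
  have hs₂0 : ∀ c, 0 ≤ s₂ c := fun c => mul_nonneg (hσ₂0 J) (mul_nonneg (Real.exp_pos _).le (Real.exp_pos _).le)
  -- the square: V₀₀ := Z, V₁₀ := W (moved at b), V₀₁ := V (moved at b'), V₁₁ := U
  have key := fourPoint_le_of_cellC11 blk T ℓ h M S c₀ f (s b) (s b') s₂ (hs0 b) (hs0 b') hs₂0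
    (fun X Z' W' V' U' hZ' hW' hV' hU' S₁ S₂ S₁₂ hS₁ hS₂ hS₁₂ h1 h2 h12 =>
      hC11 X U' V' W' Z' hU' hV' hW' hZ' S₁ S₂ S₁₂ hS₁ hS₂ hS₁₂ h1 h2 h12)
    (fun V hV => hrep V hV) Z W V U hZ hW hV hU
    (fun e => by
      have := hsens1 b W Z hW hZ hWZ e
      simpa [hs] using this)
    (fun e => by
      have := hsens1 b' V Z hV hZ hVZ e
      simpa [hs] using this)
    (fun e => by
      have := hsens2 b b' U V W Z hU hV hW hZ hUV hUW hVZ hWZ e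
      simpa [hs₂] using this)
  have hrw : (f U - f V) - (f W - f Z) = f U - f W - f V + f Z := by ring
  show |(f U - f V) - (f W - f Z)| ≤ _
  rw [hrw]
  refine key.trans ?_
  rw [Finset.sum_add_distrib]
  -- (1) the `h`-term: two-pin exchange + three-factor convolution
  have hK : ∀ c c', ∑ X ∈ Finset.univ.filter (fun X => c ∈ X ∧ c' ∈ X), h X ≤ Hc * Real.exp (-(2 * μ * d c c')) := hpin2
  have h1 := sum_mul_sum_mul_sum_supp_le (fun X : Finset (PBond (F.P J) 0) => X) h (s b) (s b')
    (fun c c' => Hc * Real.exp (-(2 * μ * d c c'))) (hs0 b) (hs0 b') hK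
  have h1' : ∑ c, ∑ c', s b c * s b' c' * (Hc * Real.exp (-(2 * μ * d c c'))) =
      σ J ^ 2 * Hc * ∑ c, ∑ c', Real.exp (-(2 * μ * d b c)) * Real.exp (-(2 * μ * d c c')) * Real.exp (-(2 * μ * d c' b')) := by
    rw [Finset.mul_sum]
    refine Finset.sum_congr rfl fun c _ => ?_
    rw [Finset.mul_sum]
    refine Finset.sum_congr rfl fun c' _ => ?_
    simp only [hs]
    rw [hdsym b' c']
    ring
  have hconv := exp_convolution_le d μ C' hμ hd0 hdtri hdsum' b b'
  have hterm1 : ∑ X, h X * (∑ c ∈ X, s b c) * (∑ c' ∈ X, s b' c') ≤ σ J ^ 2 * Hc * (C' ^ 2 * Real.exp (-(μ * d b b'))) := by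
    refine h1.trans ?_
    rw [h1']
    exact mul_le_mul_of_nonneg_left hconv (mul_nonneg (sq_nonneg _) hHc)
  -- (2) the `ℓ`-term: one-pin exchange + two-factor convolution
  have hB2 : ∑ c, s₂ c ≤ σ₂ J * (C' * Real.exp (-(μ * d b b'))) := by
    simp only [hs₂]
    rw [← Finset.mul_sum]
    exact mul_le_mul_of_nonneg_left (exp_convolution_two_le d μ C' hμ hd0 hdtri hdsum' b b') (hσ₂0 J)
  have hterm2 : ∑ X, ℓ X * ∑ c ∈ X, s₂ c ≤ A * (σ₂ J * (C' * Real.exp (-(μ * d b b')))) :=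
    sum_mul_sum_supp_le (fun X : Finset (PBond (F.P J) 0) => X) ℓ s₂ A _ hs₂0 hpin1 hB2 hA
  -- (3) compare the exponents: `κ·tdist ≤ μ·d b b'`
  have hexp : Real.exp (-(μ * d b b')) ≤ Real.exp (-(κ * (b.src.tdist b'.src : ℝ))) := by
    rw [Real.exp_le_exp]; linarith [hdcmp b b']
  have hφ1 : 0 ≤ σ J ^ 2 * Hc * C' ^ 2 := mul_nonneg (mul_nonneg (sq_nonneg _) hHc) (sq_nonneg _)
  have hφ2 : 0 ≤ A * (σ₂ J * C') := mul_nonneg hA (mul_nonneg (hσ₂0 J) hC'0)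
  calc ∑ X, h X * (∑ c ∈ X, s b c) * (∑ c' ∈ X, s b' c') + ∑ X, ℓ X * ∑ c ∈ X, s₂ c
      ≤ σ J ^ 2 * Hc * (C' ^ 2 * Real.exp (-(μ * d b b'))) + A * (σ₂ J * (C' * Real.exp (-(μ * d b b')))) :=
        add_le_add hterm1 hterm2
    _ = (σ J ^ 2 * Hc * C' ^ 2 + A * (σ₂ J * C')) * Real.exp (-(μ * d b b')) := by ring
    _ ≤ (σ J ^ 2 * Hc * C' ^ 2 + A * (σ₂ J * C')) * Real.exp (-(κ * (b.src.tdist b'.src : ℝ))) :=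
        mul_le_mul_of_nonneg_left hexp (add_nonneg hφ1 hφ2)
    _ = (Hc * C' ^ 2 * σ J ^ 2 + A * C' * σ₂ J) * Real.exp (-(κ * (b.src.tdist b'.src : ℝ))) := by ring

end Junctions

/-! ## §4 The single stub (CONTROL; the line is published, not registered) -/

section Stubs

/-- STUB BGFORM∘ (NEW, XL: print's representation theorem for the T³ scheme in BACKGROUND form + the last Mayer step; response bounds = [Balaban1985Variational] Prop. 9∕(190) + Cauchy). -/
theorem stub_fluctuationBackgroundFormCan : FluctuationBackgroundFormCan := by
  sorry

/-- CONTROL: S2β from the stub (carries `sorryAx` through the stub only). -/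
theorem fluctuationPartSmall_of_stub : FluctuationPartSmall := fluctuationPartSmall_of_backgroundForm stub_fluctuationBackgroundFormCan

/-- CONTROL: GRAD∘ from the stub. -/
theorem oneBondOscillation_of_stub : OneBondOscillationCan := oneBondOscillation_of_backgroundForm stub_fluctuationBackgroundFormCan

end Stubs

end Summit.QuantumFields.YangMills.Cruxes.FluctuationComparisonRegPrIntL.RunPairOrgan.BackgroundForm
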